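import Summits.BirchSwinnertonDyer.BirchSwinnertonDyer.Theorems.InertBadSignedBranchesCccOneLawOnTypeIstarZeroManinTwist
import Summits.BirchSwinnertonDyer.Rank1Residual.Additive.LocIrrOfSubGss
import Summits.BirchSwinnertonDyer.Rank1Residual.Additive.UnramifiedBaseChange
import HarnessLib

/-!
# Route `InertBadSignedBranches` (rung K8), crux `CccOneLawOnTypeIstarZero` (stmt-…-19223): the CM-free
# Manin theorem of `…ManinTwist` with ONE irreducibility binder and the cell's `Addv` predicate — the
# turnkey shape for additive defect-2 consumers (helper toward stmt-BirchSwinnertonDyer-19223; cell bsd-cm,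
# seat bsd-cm-k8i-c2 g6; convenience wrapper, nothing booked)

WHAT. `exists_modularParametrizationData_not_dvd_of_twist_good` (p447545) takes `W[p]` AND `V[p]`
irreducible and additivity as `W.HasAdditiveReductionAt v`. Since `V = C • W^{(p*)}`, irreducibility of
`V[p]` FOLLOWS from that of `W[p]` (quadratic-twist and change-of-model invariance:
`Additive.hasIrreducibleModPGaloisRep_quadraticTwist_iff`, `Mazur1978.hasIrreducibleModPGaloisRep_smul_iff`),
and the cell predicate `Addv W p` gives the additive place (`Additive.hasAdditiveReductionAt_of_addv`):
* `hasIrreducibleModPGaloisRep_of_twist` — `C • W^{(d)} = V`, `d ≠ 0`: `W[p]` irreducible ⟹ `V[p]`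
  irreducible;
* **`exists_modularParametrizationData_not_dvd_of_twist_good_of_addv`** — `W` globally minimal of conductor
  `N`, `p` odd, `Addv W p`, `V` globally minimal good at `p` with `C • W^{(p*)} = V`, `W[p]` irreducible
  ⟹ `∃ Dt : ModularParametrizationData W N, p ∤ c(Dt)` (facts `hnf`, `hMaz`).
Intended consumers (not booked here, other cells' decision): the defect-2 (`I₀*`) rows of the additive
classes with irreducible `E[p]` (X4) at `p ∈ {5, 7}`, whose Kolyvagin / Kim upper halves carry a Manin
datum that Edixhoven 1991 Thm. 3 supplies only at `p ≥ 11`.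

HONEST LABEL: theorems only; CONDITIONAL on `hnf` (Modularity) and `hMaz` (Mazur 1978 Cor. 4.1); nothing
booked; no statement about BSD of any curve.

References: B. Mazur, Invent. Math. 44 (1978) Cor. 4.1; G. Stevens, Invent. Math. 98 (1989) §5;
J. H. Silverman, AEC X.5 Cor. 5.4.
-/

set_option autoImplicit false
set_option linter.dupNamespace false

noncomputable section

open scoped Classical NumberField

open WeierstrassCurve NumberField IsDedekindDomain
open Literature.NumberTheory.EllipticCurves
open Literature.NumberTheory.EllipticCurves.ModularForms
open Literature.NumberTheory.EllipticCurves.Rank1Residual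
open Summit.BirchSwinnertonDyer.Rank1Residual

namespace Summit.BirchSwinnertonDyer.BirchSwinnertonDyer.Theorems.CccOneManinTwist

/-- **Irreducibility of `E[p]` passes to the twin**: if `C • W^{(d)} = V` with `d ≠ 0` then `W[p]`
irreducible ⟹ `V[p]` irreducible (`hasIrreducibleModPGaloisRep_quadraticTwist_iff`,
`hasIrreducibleModPGaloisRep_smul_iff`). [cite: SilvermanAEC2009, X.5 Cor. 5.4 and X.2 Prop. 2.4] -/
theorem hasIrreducibleModPGaloisRep_of_twist (W : WeierstrassCurve ℚ) {V : WeierstrassCurve ℚ}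
    (C : VariableChange ℚ) {d : ℚ} (hd : d ≠ 0) (hCV : C • W.quadraticTwist d = V) (p : ℕ)
    (hirr : W.HasIrreducibleModPGaloisRep p) : V.HasIrreducibleModPGaloisRep p := by
  rw [← hCV, Mazur1978.hasIrreducibleModPGaloisRep_smul_iff,
    Additive.hasIrreducibleModPGaloisRep_quadraticTwist_iff W hd p]
  exact hirr

/-- **THE MANIN CONSTANT OF A `p*`-TWIST CLASS IS PRIME TO `p` — turnkey form.** For `W/ℚ` globally
minimal of conductor `N`, `p` an odd prime with `Addv W p` (the cell's «additive at `p`»), `V/ℚ`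
globally minimal with GOOD reduction at `p` and `C • W^{(p*)} = V`, and `W[p]` irreducible:
`∃ Dt : ModularParametrizationData W N, p ∤ c(Dt)`. (`exists_modularParametrizationData_not_dvd_of_twist_good`
with the place over `p` from `Additive.hasAdditiveReductionAt_of_addv` and `V[p]` irreducible by
`hasIrreducibleModPGaloisRep_of_twist`.) CONDITIONAL on `hnf`, `hMaz`; nothing booked.
[cite: Mazur1978, Cor. 4.1] [cite: AgasheRibetStein2006, §§1–2] -/
theorem exists_modularParametrizationData_not_dvd_of_twist_good_of_addv (hnf : exists_isNewformOf)
    (hMaz : mazur_not_dvd_maninConstant_of_odd)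
    (W : WeierstrassCurve ℚ) [W.IsElliptic] [W.IsGloballyMinimal] {N : ℕ} [NeZero N]
    (hN : W.conductorNorm ℤ = N) (p : ℕ) [hp : Fact p.Prime] (hp2 : p ≠ 2) (hadd : Addv W p)
    (V : WeierstrassCurve ℚ) [V.IsElliptic] [V.IsGloballyMinimal] (C : VariableChange ℚ)
    (hCV : C • W.quadraticTwist ((-1) ^ (p / 2) * p) = V) (hgood : V.HasGoodReductionAtPrime p)
    (hirrW : W.HasIrreducibleModPGaloisRep p) :
    ∃ Dt : ModularParametrizationData W N, ¬ (p : ℤ) ∣ Dt.c :=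
  have hd0 : ((-1 : ℚ) ^ (p / 2) * p) ≠ 0 :=
    mul_ne_zero (pow_ne_zero _ (by norm_num)) (Nat.cast_ne_zero.mpr hp.out.ne_zero)
  exists_modularParametrizationData_not_dvd_of_twist_good hnf hMaz W hN p hp2
    (Additive.primesEquiv_symm_apply_coe p) (Additive.hasAdditiveReductionAt_of_addv W p hadd) V C hCV
    hgood hirrW (hasIrreducibleModPGaloisRep_of_twist W C hd0 hCV p hirrW)

end Summit.BirchSwinnertonDyer.BirchSwinnertonDyer.Theorems.CccOneManinTwist

end
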